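import Summits.NavierStokesRegularity.FluidComputer.GadgetRobustStableFailure
import HarnessLib

/-!
# Fluid computer, door N1-FC — ONE-SHOT DEGENERACY OF THE ROBUST GADGET INTERFACE, tolerances pinned: `oneShotRobustLibrary`, `nonempty_robustGadgetLibrary_iff`

HONEST FRAMING: low prior, high value-of-information experiment on Tao's machine paradigm;
NOT a claim that NS blows up.

(Cell `ns-blowup`, seat `ns-blowup-fc-prover-2`, door N1-FC «forced fluid computer»; companion of
`GadgetRobustStableFailure.lean`. WHAT THIS IS NOT: not Navier–Stokes evidence — a calibration of the
TYPED interface `Literature.Analysis.FluidPDE.FluidComputer.RobustGadgetLibrary`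
([cite: Tao2016AveragedNS, §1.3] with a stated norm); no instance for true NS is claimed.)

The PLAIN interface is exactly calibrated to the failure of global regularity for ONE datum
(`FluidComputerGadgetOneShot.lean`, `nonempty_gadgetLibrary_iff`); the ROBUST interface ties its input
classes to the stated norm `l2DistSq` with tolerance fields `rho`, `gap`, `theta`. This file carries the
one-shot construction over («OneShot → Robust») with the tolerances PINNED to arbitrary prescribed values:

* `NoGlobalRegularSolutionNear ν v r` — STABLE failure of global regularity at `v`: no field within
  energy distance `r` of `v` (ALL fields `w`, `∫ ‖w - v‖² ≤ r²`) has a global regular solution.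
* `oneShotRobustLibrary` — from ANY valid spec `σ`, ANY Clay-class `v` with `NoGlobalRegularSolutionNear
  ν v r`, and ANY prescribed `0 < rho`, `0 < gap`, `0 < theta ≤ 1`, a `RobustGadgetLibrary ν σ` with
  exactly those tolerance fields: seed `v`; level-`0` input class = the `l2DistSq`-ball of squared radius
  `R₀ = rho² E0 ≤ r²` about `v`, higher classes EMPTY; level energy `≡ E0`; `T ≡ 0`. `step` is VACUOUS
  by time translation; `robust` holds for a THREE-valued noise (`radius - gap` at the seed, `radius` on
  the ball, `radius + gap` off it) needing NO triangle inequality (`l2DistSq` is a lower Lebesgue integral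
  over arbitrary fields: Minkowski is unavailable); `floor` holds by monotonicity of the lower integral on
  a ball where `‖v‖ ≥ ‖v x₀‖ / 2` (`exists_norm_ge_of_l2DistSq_le`, `exists_oneShot_params`).
* `exists_robustGadgetLibrary_pinned_iff` / `nonempty_robustGadgetLibrary_iff` / `retolerance` — for
  valid, closing, super-threshold specs: a robust library WITH PRESCRIBED (rho, gap, theta) exists iff a
  robust library exists iff some Clay-class datum has `NoGlobalRegularSolutionNear ν v r`, `r > 0`.
* `exists_robustGadgetLibrary_iff_stable_failure` — at the summit: «some `ν > 0`, some valid closing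
  super-threshold spec, a robust library» ↔ «Clay (A) fails STABLY (an `L²`-ball of doomed data at a Clay
  datum)»; in particular `¬ NavierStokesRegularity`. The converse from `¬`(A) alone is NOT claimed.

For door N1-FC: pinning the robustness radius and the detection slack to registered numbers (a seed of
energy `ε² E`, a `2 %` floor on the efficiency) does not make the robust interface say more than "(A)
fails on an `L²`-ball" — no cascade, no second scale, no rate law; the machine content (a ROBUST ONE-SHOT
GADGET FAMILY firing level after level) needs the local, existential step semantics of the route
vocabulary (`TriggerScheme.Step`). 0 sorry; axioms ⊆ {propext, Classical.choice, Quot.sound}; three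
`def`s (`NoGlobalRegularSolutionNear`, `robustOneShotNoise`, `oneShotRobustLibrary`), no named fact.
-/

noncomputable section

open scoped ContDiff ENNReal Topology
open Filter Set Metric MeasureTheory

namespace Summit.NavierStokesRegularity.FluidComputer.GadgetRobustOneShot

open Literature.Analysis.FluidPDE Literature.Analysis.FluidPDE.FluidComputer
open Summit.NavierStokesRegularity.FluidComputer.GadgetRobustStableFailure

/-! ## Stable failure of global regularity -/

/-- `NoGlobalRegularSolutionNear ν v r`: NO field within energy distance `r` of `v` — squared `L²`
distance `l2DistSq w v ≤ r²`, ALL fields `w : ℝ³ → ℝ³`, Clay-class or not — admits a global regular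
(smooth, bounded-energy) Navier–Stokes solution with viscosity `ν` and zero force: STABLE failure of
global regularity at `v`. [folklore] -/
def NoGlobalRegularSolutionNear (ν : ℝ) (v : Vel) (r : ℝ) : Prop :=
  ∀ w : Vel, l2DistSq w v ≤ ENNReal.ofReal (r ^ 2) → NoGlobalRegularSolution ν w

/-- Stable failure at `v` contains failure at `v` itself (distance `0`). [folklore] -/
theorem NoGlobalRegularSolutionNear.self {ν : ℝ} {v : Vel} {r : ℝ}
    (h : NoGlobalRegularSolutionNear ν v r) : NoGlobalRegularSolution ν v :=
  h v (by simp)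

/-- A robust library with valid, closing, super-threshold specs exhibits stable failure at its seed,
radius `rho √E0` (`GadgetRobustStableFailure.noGlobalRegularSolution_of_l2DistSq_le`). [folklore] -/
theorem noGlobalRegularSolutionNear_seed {ν : ℝ} {σ : GadgetSpec} (lib : RobustGadgetLibrary ν σ)
    (hσ : σ.Valid) (hclos : σ.Closure) (hvisc : σ.s⁻¹ < σ.eta) :
    NoGlobalRegularSolutionNear ν lib.seed (lib.rho * Real.sqrt lib.E0) :=
  fun _ hw => noGlobalRegularSolution_of_l2DistSq_le lib hσ hclos hvisc hw

/-! ## The one-shot ROBUST library -/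

open Classical in
/-- The THREE-VALUED one-shot robust noise: at level `0`, `radius - gap` at the seed `v`, `radius` on
the `l2DistSq`-ball `{w | ∫ ‖w - v‖² ≤ R}` and `radius + gap` off it; `radius + gap` at every higher
level. Designed so that the robustness axiom holds WITHOUT any triangle inequality for `l2DistSq`
(a kick of squared size `≤ R` moves the seed into the ball, and every other state to noise
`≤ radius + gap`). [folklore] -/
noncomputable def robustOneShotNoise (σ : GadgetSpec) (gap R : ℝ) (v : Vel) (n : ℕ) (w : Vel) : ℝ :=
  if n = 0 ∧ w = v then σ.radius - gap
  else if n = 0 ∧ l2DistSq w v ≤ ENNReal.ofReal R then σ.radius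
  else σ.radius + gap

/-- The noise of the seed at level `0` is `radius - gap`. [folklore] -/
@[simp] theorem robustOneShotNoise_self (σ : GadgetSpec) (gap R : ℝ) (v : Vel) :
    robustOneShotNoise σ gap R v 0 v = σ.radius - gap := by
  simp [robustOneShotNoise]

/-- The input classes of the one-shot robust noise (`gap > 0`): level `0` admits exactly the
`l2DistSq`-ball of squared radius `R` about `v`, higher levels admit nothing. [folklore] -/
theorem robustOneShotNoise_le_iff {σ : GadgetSpec} {gap R : ℝ} (hgap : 0 < gap) {v w : Vel} {n : ℕ} :
    robustOneShotNoise σ gap R v n w ≤ σ.radius ↔ n = 0 ∧ l2DistSq w v ≤ ENNReal.ofReal R := by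
  unfold robustOneShotNoise
  split_ifs with h1 h2
  · obtain ⟨hn, rfl⟩ := h1
    simp [hn, hgap.le]
  · exact ⟨fun _ => h2, fun _ => le_rfl⟩
  · simp only [add_le_iff_nonpos_right, not_le.2 hgap, false_iff]
    exact h2

/-- THE ROBUSTNESS AXIOM FOR THE ONE-SHOT NOISE, with no metric reasoning: a state `w` within squared
energy distance `R` of ANY state `u` has noise at most `noise u + gap` (if `u` is the seed, `w` is in
the ball; otherwise `noise u ≥ radius ≥ noise w - gap`). [folklore] -/
theorem robustOneShotNoise_robust {σ : GadgetSpec} {gap R : ℝ} (hgap : 0 < gap) (v : Vel) (n : ℕ)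
    (u w : Vel) (huw : l2DistSq w u ≤ ENNReal.ofReal R) :
    robustOneShotNoise σ gap R v n w ≤ robustOneShotNoise σ gap R v n u + gap := by
  by_cases h : n = 0 ∧ u = v
  · obtain ⟨hn, rfl⟩ := h
    have hw : robustOneShotNoise σ gap R u n w ≤ σ.radius :=
      (robustOneShotNoise_le_iff hgap).2 ⟨hn, huw⟩
    subst hn
    rw [robustOneShotNoise_self]
    linarith
  · have hu : σ.radius ≤ robustOneShotNoise σ gap R v n u := by
      unfold robustOneShotNoise; rw [if_neg h]; split_ifs <;> linarith
    have hw : robustOneShotNoise σ gap R v n w ≤ σ.radius + gap := by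
      unfold robustOneShotNoise; split_ifs <;> linarith
    linarith

/-- THE CONCENTRATION LEMMA (lower-integral monotonicity only): if `‖v‖ ≥ m / 2` on the ball
`B(x₀, r₁)` and `w` is within squared energy distance `R < (m/4)² · vol B(x₀, r₁)` of `v`, then
`‖w x‖ ≥ m / 4` at some point of the ball — otherwise `‖w - v‖ > m/4` on the whole ball and
`∫⁻ ‖w - v‖² ≥ (m/4)² · vol`. No measurability of `w` is needed (`lintegral_mono`). [folklore] -/
theorem exists_norm_ge_of_l2DistSq_le {v w : Vel} {x₀ : E3} {r₁ m R : ℝ}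
    (hvx : ∀ x ∈ ball x₀ r₁, m / 2 ≤ ‖v x‖) (hm : 0 ≤ m) (hR₀ : 0 ≤ R)
    (hw : l2DistSq w v ≤ ENNReal.ofReal R)
    (hR : R < (m / 4) ^ 2 * (volume (ball x₀ r₁)).toReal) :
    ∃ x ∈ ball x₀ r₁, m / 4 ≤ ‖w x‖ := by
  by_contra hcon
  push Not at hcon
  have key : ∀ x, (ball x₀ r₁).indicator (fun _ => ENNReal.ofReal ((m / 4) ^ 2)) x ≤
      ‖w x - v x‖ₑ ^ 2 := by
    intro x
    by_cases hx : x ∈ ball x₀ r₁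
    · rw [Set.indicator_of_mem hx, ← ofReal_norm, ← ENNReal.ofReal_pow (norm_nonneg _)]
      apply ENNReal.ofReal_le_ofReal
      have h1 := hvx x hx
      have h2 := hcon x hx
      have h3 : ‖v x‖ - ‖w x‖ ≤ ‖w x - v x‖ := by
        rw [norm_sub_rev]; exact norm_sub_norm_le _ _
      exact pow_le_pow_left₀ (by linarith) (by linarith) 2
    · rw [Set.indicator_of_notMem hx]
      exact zero_le
  have h1 : ENNReal.ofReal ((m / 4) ^ 2) * volume (ball x₀ r₁) ≤ ENNReal.ofReal R :=
    calc ENNReal.ofReal ((m / 4) ^ 2) * volume (ball x₀ r₁)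
        = ∫⁻ x, (ball x₀ r₁).indicator (fun _ => ENNReal.ofReal ((m / 4) ^ 2)) x :=
          (lintegral_indicator_const measurableSet_ball _).symm
      _ ≤ l2DistSq w v := lintegral_mono key
      _ ≤ ENNReal.ofReal R := hw
  have h2 := ENNReal.toReal_mono ENNReal.ofReal_ne_top h1
  rw [ENNReal.toReal_mul, ENNReal.toReal_ofReal (by positivity), ENNReal.toReal_ofReal hR₀] at h2
  linarith

/-- CONCENTRATION PARAMETERS EXIST for every continuous datum without a global regular solution: a
point `x₀` with `v x₀ ≠ 0` (`exists_ne_zero_of_noGlobalRegularSolution`), a ball `B(x₀, r₁)` on which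
`‖v‖ ≥ m/2`, `m = ‖v x₀‖ > 0`, and a squared radius `0 < R₀ ≤ r²` with `R₀ < (m/4)² · vol B(x₀, r₁)`
(the ball has positive finite volume). [folklore] -/
theorem exists_oneShot_params {ν : ℝ} {v : Vel} (hv : Continuous v) {r : ℝ} (hr : 0 < r)
    (H : NoGlobalRegularSolution ν v) :
    ∃ (x₀ : E3) (r₁ m R₀ : ℝ), 0 < m ∧ 0 < r₁ ∧ (∀ x ∈ ball x₀ r₁, m / 2 ≤ ‖v x‖) ∧
      0 < R₀ ∧ R₀ ≤ r ^ 2 ∧ R₀ < (m / 4) ^ 2 * (volume (ball x₀ r₁)).toReal := by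
  obtain ⟨x₀, hx₀⟩ := exists_ne_zero_of_noGlobalRegularSolution H
  have hm : 0 < ‖v x₀‖ := norm_pos_iff.2 hx₀
  have hc : ContinuousAt (fun x => ‖v x‖) x₀ := hv.norm.continuousAt
  obtain ⟨r₁, hr₁, hball⟩ := Metric.continuousAt_iff.1 hc (‖v x₀‖ / 2) (half_pos hm)
  have hMpos : 0 < (volume (ball x₀ r₁)).toReal :=
    ENNReal.toReal_pos (Metric.measure_ball_pos volume x₀ hr₁).ne' measure_ball_lt_top.ne
  refine ⟨x₀, r₁, ‖v x₀‖, min (r ^ 2) ((‖v x₀‖ / 4) ^ 2 * (volume (ball x₀ r₁)).toReal / 2),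
    hm, hr₁, ?_, lt_min (pow_pos hr 2) (by positivity), min_le_left _ _, ?_⟩
  · intro x hx
    have h := hball (mem_ball.1 hx)
    rw [Real.dist_eq] at h
    have h' := (abs_lt.1 h).1
    linarith
  · have hpos : 0 < (‖v x₀‖ / 4) ^ 2 * (volume (ball x₀ r₁)).toReal := by positivity
    calc min (r ^ 2) ((‖v x₀‖ / 4) ^ 2 * (volume (ball x₀ r₁)).toReal / 2)
        ≤ (‖v x₀‖ / 4) ^ 2 * (volume (ball x₀ r₁)).toReal / 2 := min_le_right _ _
      _ < (‖v x₀‖ / 4) ^ 2 * (volume (ball x₀ r₁)).toReal := by linarith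

/-- **THE ONE-SHOT ROBUST GADGET LIBRARY, tolerances prescribed.** Data: any valid spec `σ`; a
Clay-class datum `v` (smooth, divergence free, rapidly decaying) with STABLE failure of global
regularity `NoGlobalRegularSolutionNear ν v r`; concentration parameters as in `exists_oneShot_params`
(`‖v‖ ≥ m/2 > 0` on `B(x₀, r₁)`, `0 < R₀ ≤ r²`, `R₀ < (m/4)² vol B(x₀, r₁)`); and ANY tolerance triple
`0 < rho`, `0 < gap`, `0 < theta ≤ 1`. The library: seed `v`; templates / input classes = the
`l2DistSq`-ball of squared radius `R₀` about `v` at level `0`, `∅` above (`robustOneShotNoise`);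
level energy `≡ E0 := R₀ / rho²` (so the robustness ball `rho² E0 = R₀` IS the input class); `T ≡ 0`;
nest radius `‖x₀‖ + r₁`, floor constant `(m/4)² / (k0³ E0)`. `step` is VACUOUS (no global regular
solution passes through the ball, `ne_of_noGlobalRegularSolution`); `robust` is
`robustOneShotNoise_robust` plus `theta · E0 ≤ E0`; `floor` is `exists_norm_ge_of_l2DistSq_le`.
No cascade, no second scale, no rate law, at any prescribed tolerances. [folklore] -/
def oneShotRobustLibrary (ν : ℝ) {σ : GadgetSpec} (hσ : σ.Valid) {v : Vel}
    (hv₁ : ContDiff ℝ ∞ v) (hv₂ : NSWave0.IsDivFree v) (hv₃ : HasRapidSpatialDecay v)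
    {r : ℝ} (H : NoGlobalRegularSolutionNear ν v r)
    {x₀ : E3} {r₁ m R₀ : ℝ} (hm : 0 < m) (hvx : ∀ x ∈ ball x₀ r₁, m / 2 ≤ ‖v x‖)
    (hR₀ : 0 < R₀) (hR₀r : R₀ ≤ r ^ 2) (hR₀v : R₀ < (m / 4) ^ 2 * (volume (ball x₀ r₁)).toReal)
    {rho gap theta : ℝ} (hrho : 0 < rho) (hgap : 0 < gap) (hθ : 0 < theta) (hθ₁ : theta ≤ 1) :
    RobustGadgetLibrary ν σ where
  template n := if n = 0 then {w | l2DistSq w v ≤ ENNReal.ofReal R₀} else ∅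
  noise := robustOneShotNoise σ gap R₀ v
  levelEnergy _ _ := R₀ / rho ^ 2
  T _ := 0
  T_nonneg _ := le_rfl
  T_le_Tmax n := GadgetSpec.Tmax_nonneg hσ n
  seed := v
  seed_smooth := hv₁
  seed_divFree := hv₂
  seed_decay := hv₃
  seed_noise := by
    rw [robustOneShotNoise_self]
    linarith
  E0 := R₀ / rho ^ 2
  E0_pos := div_pos hR₀ (pow_pos hrho 2)
  seed_energy := le_rfl
  step := by
    intro u₀ u p hu hp hsol hE n t ht hn
    obtain ⟨-, hdist⟩ := (robustOneShotNoise_le_iff hgap).1 hn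
    exact absurd rfl (ne_of_noGlobalRegularSolution
      (H (u t) (hdist.trans (ENNReal.ofReal_le_ofReal hR₀r))) hu hp hsol hE ht)
  R := ‖x₀‖ + r₁
  cFloor := (m / 4) ^ 2 / (σ.k 0 ^ 3 * (R₀ / rho ^ 2))
  cFloor_pos := div_pos (pow_pos (by linarith) 2)
    (mul_pos (pow_pos (GadgetSpec.k_pos hσ 0) 3) (div_pos hR₀ (pow_pos hrho 2)))
  floor := by
    intro n w hw
    obtain ⟨hn, hdist⟩ := (robustOneShotNoise_le_iff hgap).1 hw
    subst hn
    obtain ⟨x, hx, hwx⟩ := exists_norm_ge_of_l2DistSq_le hvx hm.le hR₀.le hdist hR₀v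
    refine ⟨x, ?_, ?_⟩
    · have h1 : ‖x - x₀‖ < r₁ := by rw [← dist_eq_norm]; exact mem_ball.1 hx
      have h2 : ‖x‖ ≤ ‖x₀‖ + ‖x - x₀‖ := by
        have := norm_add_le x₀ (x - x₀)
        rwa [add_sub_cancel] at this
      linarith
    · have hk : 0 < σ.k 0 ^ 3 * (R₀ / rho ^ 2) :=
        mul_pos (pow_pos (GadgetSpec.k_pos hσ 0) 3) (div_pos hR₀ (pow_pos hrho 2))
      calc (m / 4) ^ 2 / (σ.k 0 ^ 3 * (R₀ / rho ^ 2)) * σ.k 0 ^ 3 * (R₀ / rho ^ 2)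
          = (m / 4) ^ 2 / (σ.k 0 ^ 3 * (R₀ / rho ^ 2)) * (σ.k 0 ^ 3 * (R₀ / rho ^ 2)) := by ring
        _ = (m / 4) ^ 2 := div_mul_cancel₀ _ hk.ne'
        _ ≤ ‖w x‖ ^ 2 := pow_le_pow_left₀ (by linarith) hwx 2
  rho := rho
  rho_pos := hrho
  gap := gap
  gap_pos := hgap
  theta := theta
  theta_pos := hθ
  theta_le_one := hθ₁
  seed_margin := by
    rw [robustOneShotNoise_self]
    linarith
  robust := by
    intro n u w huw
    have hR : rho ^ 2 * (R₀ / rho ^ 2) = R₀ := by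
      field_simp
    change l2DistSq w u ≤ ENNReal.ofReal (rho ^ 2 * (R₀ / rho ^ 2)) at huw
    rw [hR] at huw
    exact ⟨robustOneShotNoise_robust hgap v n u w huw,
      mul_le_of_le_one_left (div_pos hR₀ (pow_pos hrho 2)).le hθ₁⟩

section oneShot

variable (ν : ℝ) {σ : GadgetSpec} (hσ : σ.Valid) {v : Vel}
  (hv₁ : ContDiff ℝ ∞ v) (hv₂ : NSWave0.IsDivFree v) (hv₃ : HasRapidSpatialDecay v)
  {r : ℝ} (H : NoGlobalRegularSolutionNear ν v r)
  {x₀ : E3} {r₁ m R₀ : ℝ} (hm : 0 < m) (hvx : ∀ x ∈ ball x₀ r₁, m / 2 ≤ ‖v x‖)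
  (hR₀ : 0 < R₀) (hR₀r : R₀ ≤ r ^ 2) (hR₀v : R₀ < (m / 4) ^ 2 * (volume (ball x₀ r₁)).toReal)
  {rho gap theta : ℝ} (hrho : 0 < rho) (hgap : 0 < gap) (hθ : 0 < theta) (hθ₁ : theta ≤ 1)

/-- The input classes of the one-shot robust library: the `l2DistSq`-ball of squared radius `R₀`
about the seed at level `0`, EMPTY above — no cascade, at any prescribed tolerances. [folklore] -/
theorem oneShotRobustLibrary_inputClass (n : ℕ) :
    (oneShotRobustLibrary ν hσ hv₁ hv₂ hv₃ H hm hvx hR₀ hR₀r hR₀v hrho hgap hθ hθ₁).inputClass n =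
      if n = 0 then {w | l2DistSq w v ≤ ENNReal.ofReal R₀} else ∅ := by
  ext w
  simp only [GadgetLibrary.inputClass, Set.mem_setOf_eq]
  change robustOneShotNoise σ gap R₀ v n w ≤ σ.radius ↔ _
  rw [robustOneShotNoise_le_iff hgap]
  split_ifs with h
  · simp [h]
  · simp [h]

end oneShot

/-! ## Calibration of the robust interface, tolerances pinned -/

/-- EXISTENCE AT PRESCRIBED TOLERANCES: a valid spec, a Clay-class datum with stable failure of global
regularity on a ball of radius `r > 0`, and any `0 < rho`, `0 < gap`, `0 < theta ≤ 1` give a robust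
gadget library with exactly those tolerance fields and that seed. [folklore] -/
theorem exists_robustGadgetLibrary_of_noGlobalRegularSolutionNear (ν : ℝ) {σ : GadgetSpec}
    (hσ : σ.Valid) {v : Vel} (hv₁ : ContDiff ℝ ∞ v) (hv₂ : NSWave0.IsDivFree v)
    (hv₃ : HasRapidSpatialDecay v) {r : ℝ} (hr : 0 < r) (H : NoGlobalRegularSolutionNear ν v r)
    {rho gap theta : ℝ} (hrho : 0 < rho) (hgap : 0 < gap) (hθ : 0 < theta) (hθ₁ : theta ≤ 1) :
    ∃ lib : RobustGadgetLibrary ν σ,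
      lib.rho = rho ∧ lib.gap = gap ∧ lib.theta = theta ∧ lib.seed = v := by
  obtain ⟨x₀, r₁, m, R₀, hm, hr₁, hvx, hR₀, hR₀r, hR₀v⟩ :=
    exists_oneShot_params hv₁.continuous hr H.self
  exact ⟨oneShotRobustLibrary ν hσ hv₁ hv₂ hv₃ H hm hvx hR₀ hR₀r hR₀v hrho hgap hθ hθ₁,
    rfl, rfl, rfl, rfl⟩

/-- **ONE-SHOT DEGENERACY OF THE ROBUST INTERFACE, TOLERANCES PINNED.** For a valid, closing,
super-threshold spec (`σ.Valid`, `σ.Closure`, `s⁻¹ < eta` — the hypotheses of the blow-up theorems)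
and ANY prescribed tolerance triple `0 < rho`, `0 < gap`, `0 < theta ≤ 1`: a robust gadget library for
viscosity `ν` WITH EXACTLY THOSE TOLERANCE FIELDS exists if and only if some Clay-class datum exhibits
STABLE failure of global regularity at viscosity `ν` (an `L²`-ball of data without global regular
solutions). Pinning the robustness radius / slack / retention — e.g. to a registered seed energy and
detection floor — buys no cascade, no second scale and no rate law. HONEST FRAMING: a calibration of a
typed interface; NOT a claim that NS blows up. [folklore] -/
theorem exists_robustGadgetLibrary_pinned_iff {ν : ℝ} {σ : GadgetSpec} (hσ : σ.Valid)
    (hclos : σ.Closure) (hvisc : σ.s⁻¹ < σ.eta) {rho gap theta : ℝ} (hrho : 0 < rho)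
    (hgap : 0 < gap) (hθ : 0 < theta) (hθ₁ : theta ≤ 1) :
    (∃ lib : RobustGadgetLibrary ν σ, lib.rho = rho ∧ lib.gap = gap ∧ lib.theta = theta) ↔
      ∃ v : Vel, ContDiff ℝ ∞ v ∧ NSWave0.IsDivFree v ∧ HasRapidSpatialDecay v ∧
        ∃ r : ℝ, 0 < r ∧ NoGlobalRegularSolutionNear ν v r := by
  constructor
  · rintro ⟨lib, -, -, -⟩
    exact ⟨lib.seed, lib.seed_smooth, lib.seed_divFree, lib.seed_decay, lib.rho * Real.sqrt lib.E0,
      rho_mul_sqrt_E0_pos lib, noGlobalRegularSolutionNear_seed lib hσ hclos hvisc⟩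
  · rintro ⟨v, hv₁, hv₂, hv₃, r, hr, H⟩
    obtain ⟨lib, h1, h2, h3, -⟩ := exists_robustGadgetLibrary_of_noGlobalRegularSolutionNear ν hσ
      hv₁ hv₂ hv₃ hr H hrho hgap hθ hθ₁
    exact ⟨lib, h1, h2, h3⟩

/-- **ONE-SHOT DEGENERACY OF THE ROBUST INTERFACE.** For a valid, closing, super-threshold spec, a
robust gadget library for viscosity `ν` EXISTS if and only if some Clay-class datum exhibits stable
failure of global regularity at viscosity `ν`: the robust interface AS TYPED is exactly calibrated to
STABLE `¬`(global regularity) — one `L²`-ball of doomed data — and carries no machine content beyond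
it (compare `nonempty_gadgetLibrary_iff`: the plain interface ↔ ONE doomed datum). HONEST FRAMING: a
calibration of a typed interface; NOT a claim that NS blows up. [folklore] -/
theorem nonempty_robustGadgetLibrary_iff {ν : ℝ} {σ : GadgetSpec} (hσ : σ.Valid) (hclos : σ.Closure)
    (hvisc : σ.s⁻¹ < σ.eta) :
    Nonempty (RobustGadgetLibrary ν σ) ↔
      ∃ v : Vel, ContDiff ℝ ∞ v ∧ NSWave0.IsDivFree v ∧ HasRapidSpatialDecay v ∧
        ∃ r : ℝ, 0 < r ∧ NoGlobalRegularSolutionNear ν v r := by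
  constructor
  · rintro ⟨lib⟩
    exact ⟨lib.seed, lib.seed_smooth, lib.seed_divFree, lib.seed_decay, lib.rho * Real.sqrt lib.E0,
      rho_mul_sqrt_E0_pos lib, noGlobalRegularSolutionNear_seed lib hσ hclos hvisc⟩
  · rintro ⟨v, hv₁, hv₂, hv₃, r, hr, H⟩
    obtain ⟨lib, -⟩ := exists_robustGadgetLibrary_of_noGlobalRegularSolutionNear ν hσ hv₁ hv₂ hv₃
      hr H one_pos one_pos one_pos le_rfl
    exact ⟨lib⟩

/-- A robust library at SOME tolerances yields one at ANY prescribed tolerances (through the stable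
failure of global regularity it exhibits): the tolerance fields of the interface as typed constrain
nothing. [folklore] -/
theorem retolerance {ν : ℝ} {σ : GadgetSpec} (hσ : σ.Valid) (hclos : σ.Closure)
    (hvisc : σ.s⁻¹ < σ.eta) (lib : RobustGadgetLibrary ν σ) {rho gap theta : ℝ} (hrho : 0 < rho)
    (hgap : 0 < gap) (hθ : 0 < theta) (hθ₁ : theta ≤ 1) :
    ∃ lib' : RobustGadgetLibrary ν σ,
      lib'.rho = rho ∧ lib'.gap = gap ∧ lib'.theta = theta ∧ lib'.seed = lib.seed :=
  exists_robustGadgetLibrary_of_noGlobalRegularSolutionNear ν hσ lib.seed_smooth lib.seed_divFree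
    lib.seed_decay (rho_mul_sqrt_E0_pos lib) (noGlobalRegularSolutionNear_seed lib hσ hclos hvisc)
    hrho hgap hθ hθ₁

/-! ## At the summit: STABLE failure of Clay (A) -/

/-- Stable failure of global regularity at a Clay-class datum, at a viscosity `ν > 0`, refutes Clay (A)
`NavierStokesRegularity` — already at the centre of the ball. An implication; NOT a claim that NS
blows up. [folklore] -/
theorem not_navierStokesRegularity_of_noGlobalRegularSolutionNear {ν : ℝ} (hν : 0 < ν) {v : Vel}
    (hv₁ : ContDiff ℝ ∞ v) (hv₂ : NSWave0.IsDivFree v) (hv₃ : HasRapidSpatialDecay v) {r : ℝ}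
    (H : NoGlobalRegularSolutionNear ν v r) : ¬ NavierStokesRegularity := fun hNS =>
  H.self (hNS ν hν v hv₁ hv₂ hv₃)

/-- **THE ROBUST INTERFACE, READ AT THE SUMMIT.** A robust gadget library exists for some viscosity
`ν > 0` and some valid, closing, super-threshold spec if and only if Clay (A) fails STABLY: at some
`ν > 0` some Clay-class datum carries an `L²`-ball of data without global regular solutions. (Compare
`Summit.NavierStokesRegularity.NavierStokesRegularity.Theorems.not_navierStokesRegularity_iff_exists_gadgetLibrary`:
the PLAIN interface ↔ `¬ NavierStokesRegularity`.) The right-hand side implies `¬ NavierStokesRegularity`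
(`not_navierStokesRegularity_of_noGlobalRegularSolutionNear`); the converse — failure of (A) at one datum
⇒ a robust library — is NOT claimed. `⇐` uses the unit spec `s = 2`, `k0 = 1`, `alpha = 1`, `Cplus = 0`,
`eta = 1`, `leak = dStar = amp = 0`, `radius = 1`. HONEST FRAMING: a calibration of a typed interface;
NOT a claim that NS blows up. [folklore] -/
theorem exists_robustGadgetLibrary_iff_stable_failure :
    (∃ ν : ℝ, 0 < ν ∧ ∃ σ : GadgetSpec, σ.Valid ∧ σ.Closure ∧ σ.s⁻¹ < σ.eta ∧
        Nonempty (RobustGadgetLibrary ν σ)) ↔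
      ∃ ν : ℝ, 0 < ν ∧ ∃ v : Vel, ContDiff ℝ ∞ v ∧ NSWave0.IsDivFree v ∧ HasRapidSpatialDecay v ∧
        ∃ r : ℝ, 0 < r ∧ NoGlobalRegularSolutionNear ν v r := by
  constructor
  · rintro ⟨ν, hν, σ, hσ, hclos, hvisc, hne⟩
    exact ⟨ν, hν, (nonempty_robustGadgetLibrary_iff hσ hclos hvisc).1 hne⟩
  · rintro ⟨ν, hν, h⟩
    have hval : GadgetSpec.Valid ⟨2, 1, 1, 0, 1, 0, 0, 0, 1⟩ := by constructor <;> norm_num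
    have hclos : GadgetSpec.Closure ⟨2, 1, 1, 0, 1, 0, 0, 0, 1⟩ := ⟨by norm_num⟩
    have hvisc : (⟨2, 1, 1, 0, 1, 0, 0, 0, 1⟩ : GadgetSpec).s⁻¹ <
        (⟨2, 1, 1, 0, 1, 0, 0, 0, 1⟩ : GadgetSpec).eta := by
      norm_num
    exact ⟨ν, hν, ⟨2, 1, 1, 0, 1, 0, 0, 0, 1⟩, hval, hclos, hvisc,
      (nonempty_robustGadgetLibrary_iff hval hclos hvisc).2 h⟩

end Summit.NavierStokesRegularity.FluidComputer.GadgetRobustOneShot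

end
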